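import Literature.NumberTheory.LFunctions.SchoenfeldExplicit
import Literature.NumberTheory.LFunctions.SchoenfeldExplicitNumerics
import HarnessLib

/-!
# Schoenfeld 1976, Cor. 1: `Literature.NumberTheory.LFunctions.schoenfeld_explicit` from Theorem 10 and the two tables

Topic: `Literature/NumberTheory/LFunctions` (trunk T-ANT, family RH). Assembly step of the
provefact `Literature.NumberTheory.LFunctions.schoenfeld_explicit` (`RHConditionalFacts.lean`; L. Schoenfeld, Math. Comp. 30
(1976), 337–360, Cor. 1, (6.18): under RH, `|π(x) − li(x)| < √x log x/(8π)` for `x ≥ 2657`).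

`SchoenfeldExplicit.lean` proves `schoenfeld_explicit_of_parts`: (6.18) follows from Theorem 10
((6.1), `Schoenfeld1976_thm10`; (6.3), `Schoenfeld1976_theta`), the Brent and Appel–Rosser tables
(`Schoenfeld1976_brentRange`, `Schoenfeld1976_eq620`, `Schoenfeld1976_eq620'`), an anchor
`ξ ∈ [599, 23·10⁸]` with `|ξ'| ≤ √ξ/(4π)`, and the direct calculation on `[2657, 2659)`.
`SchoenfeldExplicitNumerics.lean` certifies the last two by kernel computation
(`SchoenfeldNumerics.schoenfeld_anchor_10000`, `SchoenfeldNumerics.schoenfeld_smallRange`).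
This file puts them together:

* `schoenfeld_explicit_of_facts : Schoenfeld1976_thm10 → Schoenfeld1976_theta →
    Schoenfeld1976_brentRange → Schoenfeld1976_eq620 → Schoenfeld1976_eq620' → schoenfeld_explicit`.

So `Literature.NumberTheory.LFunctions.schoenfeld_explicit` is reduced to exactly its printed non-elementary inputs:
Schoenfeld's Theorem 10 under RH (the explicit formula for `ψ` with Rosser's explicit `N(T)`) and two
published finite computations (Brent 1975, Table 1, on `[5·10⁷, 49·10⁸]`; the Appel–Rosser table (6.20) on
`[2659, 5·10⁷]`). `schoenfeld_explicit_holds` will be this theorem applied to their discharges.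

## References

* L. Schoenfeld, *Sharper bounds for the Chebyshev functions θ(x) and ψ(x). II*, Math. Comp. 30
  (1976), 337–360, Thm. 10, Cor. 1 and its proof (pp. 337–340). [Schoenfeld1976]
-/

namespace Literature.NumberTheory.LFunctions

/-- **Schoenfeld 1976, Cor. 1 (6.18), from its printed ingredients**: under the named facts
Theorem 10 (6.1) (`Schoenfeld1976_thm10`) and (6.3) (`Schoenfeld1976_theta`), Brent's table on
`[5·10⁷, 49·10⁸]` and the Appel–Rosser bounds (6.20) on `[3169, 5·10⁷]`, `[2659, 3169]`, the fact
`Literature.NumberTheory.LFunctions.schoenfeld_explicit` holds; the anchor `ξ = 10⁴` and the range `[2657, 2659)` are the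
kernel-certified `SchoenfeldNumerics.schoenfeld_anchor_10000`,
`SchoenfeldNumerics.schoenfeld_smallRange`.
[cite: Schoenfeld1976, Cor. 1 (6.18) and its proof (pp. 339–340)] -/
theorem schoenfeld_explicit_of_facts (h61 : Schoenfeld1976_thm10) (h63 : Schoenfeld1976_theta)
    (hB : Schoenfeld1976_brentRange) (h620 : Schoenfeld1976_eq620)
    (h620' : Schoenfeld1976_eq620') : schoenfeld_explicit :=
  schoenfeld_explicit_of_parts h61 h63 hB h620 h620' (ξ := 10000) (by norm_num) (by norm_num)
    SchoenfeldNumerics.schoenfeld_anchor_10000 SchoenfeldNumerics.schoenfeld_smallRange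

end Literature.NumberTheory.LFunctions
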